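import Mathlib
import Summits.Ventures.HodgeRepro2.T5CyclotomicSubfieldSatake
import Summits.Ventures.HodgeRepro2.T5RecordSatakeSplitToy

/-!
# THE EXCEPTIONAL SET OF THE RECORD'S HECKE COMMUTATIVITY, EXPLICIT FOR EVERY CM SUBFIELD OF `ℚ(ζₘ)`

Tier-5 support N3 / §G-N4.2 (seat p3, gen 82). File 234 / 236 (R9 of T5-SATAKE-KERNEL-p3.md) proves that the
record's spherical Hecke algebra `H(U(1 ⊗ H), K_v)` is commutative at every place `w ∣ v` with `e(w/v) = 1` and
`w ∉ badSet H`, and that SOME finite set of places of `K⁺` carries every exception. For a CM subfield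
`F ⊆ ℚ(ζₘ)` the exceptional set is now EXPLICIT: it is contained in the places above the primes dividing `m`
together with the bad places of `H`. The dichotomy of file 293 (a place `v` of `F⁺` above `p ∤ m` stays prime in `F`
iff `(−1) · H_F ∈ ⟨p · H_F⟩`, and has exactly two primes above it otherwise) feeds the two commutativity theorems of
the record — file 236's `heckeAlgebra_mul_comm_record_of_staysPrime` and file 250's
`heckeAlgebra_mul_comm_record_of_ne_of_liesOver`:

* `RecordCommutative K v l k H` / `RecordPolynomial K v l k H` — «`H(U(1 ⊗ H), K_v)` is commutative» / «is
  `k[X]`», packaged as `Prop`s over a variable CM field `K` (the device of file 291: stated on the subtype `↥F` the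
  unfolded statements exceed the instance-search budget);
* `recordCommutative_of_map_eq`, `recordPolynomial_of_map_eq` (stays prime), `recordCommutative_of_ne_of_liesOver`,
  `exists_ne_liesOver_of_ncard_primesOver_eq_two`, `recordCommutative_of_ncard_primesOver_eq_two` (two places) —
  the generic bridges;
* **`recordCommutative_cyclotomic_subfield`** — for EVERY CM subfield `F ⊆ ℚ(ζₘ)`, every `p ∤ m`, every place `v`
  of `F⁺` above `p` and every `H` good at the places above `v`, `H(U(1 ⊗ H), K_v)` is commutative;
  **`recordPolynomial_cyclotomic_subfield_of_mem`** — it is `k[X]` when `(−1) · H_F ∈ ⟨p · H_F⟩`;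
* **`recordCommutative_cyclotomic_subfield_of_notMem`** — the intrinsic form: commutative at every place `v` of
  `F⁺` with `m ∉ v` (good for `H`), with `coprime_of_notMem` (`m ∉ v`, `v ∣ p` ⇒ `p ∤ m`) and
  `exists_prime_liesOver_of_notMem` (such a `v` lies above a prime `p ∤ m`).

§8(d): uses an L-value-free non-vanishing device: NO.
-/

open Matrix NumberField NumberField.IsCMField IsDedekindDomain IsDedekindDomain.HeightOneSpectrum Module Polynomial
open scoped TensorProduct Pointwise
open Summit.Ventures.HodgeRepro2.T5UnitaryGroupForm Summit.Ventures.HodgeRepro2.T5UnitaryHeckeAdjoint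
  Summit.Ventures.HodgeRepro2.T5HeckePermutationModule Summit.Ventures.HodgeRepro2.T5HeckeDoubleCoset
  Summit.Ventures.HodgeRepro2.T5RecordHyperspecial Summit.Ventures.HodgeRepro2.T5GlobalLatticeAlmostAll
  Summit.Ventures.HodgeRepro2.T5FinitePlaceSplitClassification Summit.Ventures.HodgeRepro2.T5RecordSatakeIntrinsic
  Summit.Ventures.HodgeRepro2.T5SplitPlaceUnitaryGroup Summit.Ventures.HodgeRepro2.T5NonSplitPlaceUnitaryGroup
  Summit.Ventures.HodgeRepro2.T5FinitePlaceCM Summit.Ventures.HodgeRepro2.T5StarOfInvolution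
  Summit.Ventures.HodgeRepro2.T5RecordSatakeSplitToy Summit.Ventures.HodgeRepro2.T5CyclotomicSevenHeckeCommutative
  Summit.Ventures.HodgeRepro2.T5CyclotomicSubfieldInertiaDeg
  Summit.Ventures.HodgeRepro2.T5CyclotomicSubfieldDecomposition

namespace Summit.Ventures.HodgeRepro2.T5CyclotomicSubfieldHeckeCommutative

section Generic

variable (K : Type*) [Field K] [NumberField K] [IsCMField K]
variable (v : HeightOneSpectrum (𝓞 (maximalRealSubfield K)))

/-- **The record's spherical Hecke algebra at `v` is commutative**, packaged as a `Prop` over a variable CM field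
`K` (the device of file 291): `T S = S T` for all `T, S ∈ H(U(1 ⊗ H), K_v)`. -/
def RecordCommutative {r : ℕ} (l : Fin r → 𝓞 K) (k : Type*) [Field k] (H : Matrix (Fin 3) (Fin 3) K) : Prop :=
  ∀ T S : (letI := tensorStarRing K v; ↥(heckeAlgebra k (recordHyperspecial K v l H))), T * S = S * T

/-- **The record's spherical Hecke algebra at `v` is a polynomial algebra `k[X]`**, packaged as a `Prop`. -/
def RecordPolynomial {r : ℕ} (l : Fin r → 𝓞 K) (k : Type*) [Field k] (H : Matrix (Fin 3) (Fin 3) K) : Prop :=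
  Nonempty (k[X] ≃ₐ[k] (letI := tensorStarRing K v; ↥(heckeAlgebra k (recordHyperspecial K v l H))))

variable {r : ℕ} (l : Fin r → 𝓞 K) (k : Type*) [Field k]

/-- **Stays prime ⇒ commutative** (file 236's `heckeAlgebra_mul_comm_record_of_staysPrime`). -/
theorem recordCommutative_of_map_eq (w : HeightOneSpectrum (𝓞 K))
    (hmap : Ideal.map (algebraMap (𝓞 (maximalRealSubfield K)) (𝓞 K)) v.asIdeal = w.asIdeal)
    (hl : Submodule.span (𝓞 (maximalRealSubfield K)) (Set.range l) = ⊤)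
    {H : Matrix (Fin 3) (Fin 3) K} (hH : H.IsHermitian) (hdet : IsUnit H.det) (hgood : w ∉ badSet H) :
    RecordCommutative K v l k H :=
  haveI := liesOver_of_map_eq K v w hmap
  fun T S => heckeAlgebra_mul_comm_record_of_staysPrime K v w l k hl hmap hH hdet hgood T S

/-- **Stays prime ⇒ `k[X]`** (file 236's `nonempty_algEquiv_polynomial_record_of_staysPrime`). -/
theorem recordPolynomial_of_map_eq (w : HeightOneSpectrum (𝓞 K))
    (hmap : Ideal.map (algebraMap (𝓞 (maximalRealSubfield K)) (𝓞 K)) v.asIdeal = w.asIdeal)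
    (hl : Submodule.span (𝓞 (maximalRealSubfield K)) (Set.range l) = ⊤)
    {H : Matrix (Fin 3) (Fin 3) K} (hH : H.IsHermitian) (hdet : IsUnit H.det) (hgood : w ∉ badSet H) :
    RecordPolynomial K v l k H :=
  haveI := liesOver_of_map_eq K v w hmap
  nonempty_algEquiv_polynomial_record_of_staysPrime K v w l k hl hmap hH hdet hgood

/-- **Two distinct places above `v` ⇒ commutative** (file 250's `heckeAlgebra_mul_comm_record_of_ne_of_liesOver`). -/
theorem recordCommutative_of_ne_of_liesOver (w₁ w₂ : HeightOneSpectrum (𝓞 K)) (hne : w₁ ≠ w₂)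
    [w₁.asIdeal.LiesOver v.asIdeal] [w₂.asIdeal.LiesOver v.asIdeal]
    (hl : Submodule.span (𝓞 (maximalRealSubfield K)) (Set.range l) = ⊤)
    {H : Matrix (Fin 3) (Fin 3) K} (hH : H.IsHermitian) (hdet : IsUnit H.det) (hgood : w₁ ∉ badSet H) :
    RecordCommutative K v l k H :=
  fun T S => heckeAlgebra_mul_comm_record_of_ne_of_liesOver K v w₁ w₂ l k hl hne hH hdet hgood T S

omit [NumberField K] [IsCMField K] in
/-- **Two primes above `v` give two distinct places of `K` over `v`.** -/
theorem exists_ne_liesOver_of_ncard_primesOver_eq_two (h2 : (v.asIdeal.primesOver (𝓞 K)).ncard = 2) :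
    ∃ w₁ w₂ : HeightOneSpectrum (𝓞 K), w₁ ≠ w₂ ∧ w₁.asIdeal.LiesOver v.asIdeal ∧
      w₂.asIdeal.LiesOver v.asIdeal := by
  obtain ⟨x, z, hxz, hs⟩ := Set.ncard_eq_two.mp h2
  have hx : x ∈ v.asIdeal.primesOver (𝓞 K) := by rw [hs]; exact Set.mem_insert x _
  have hz : z ∈ v.asIdeal.primesOver (𝓞 K) := by rw [hs]; exact Set.mem_insert_of_mem x rfl
  haveI := hx.1
  haveI := hx.2
  haveI := hz.1
  haveI := hz.2
  refine ⟨⟨x, hx.1, Ideal.ne_bot_of_liesOver_of_ne_bot v.ne_bot x⟩,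
    ⟨z, hz.1, Ideal.ne_bot_of_liesOver_of_ne_bot v.ne_bot z⟩, ?_, hx.2, hz.2⟩
  intro h
  exact hxz (congrArg HeightOneSpectrum.asIdeal h)

/-- **Two primes above `v` ⇒ commutative**, for `H` good at every place above `v`. -/
theorem recordCommutative_of_ncard_primesOver_eq_two (h2 : (v.asIdeal.primesOver (𝓞 K)).ncard = 2)
    (hl : Submodule.span (𝓞 (maximalRealSubfield K)) (Set.range l) = ⊤)
    {H : Matrix (Fin 3) (Fin 3) K} (hH : H.IsHermitian) (hdet : IsUnit H.det)
    (hbad : ∀ w : HeightOneSpectrum (𝓞 K), w.asIdeal.LiesOver v.asIdeal → w ∉ badSet H) :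
    RecordCommutative K v l k H := by
  obtain ⟨w₁, w₂, hne, h₁, h₂⟩ := exists_ne_liesOver_of_ncard_primesOver_eq_two K v h2
  exact recordCommutative_of_ne_of_liesOver K v l k w₁ w₂ hne hl hH hdet (hbad w₁ h₁)

end Generic

section Cyclotomic

variable (m : ℕ) [NeZero m] (L : Type*) [Field L] [NumberField L] [IsCyclotomicExtension {m} ℚ L] [IsCMField L]
  (F : IntermediateField ℚ L) [IsCMField F]
variable (p : ℕ) [hp : Fact p.Prime] (hpm : p.Coprime m)
  (𝔭 : Ideal (𝓞 F)) [h𝔭 : 𝔭.IsPrime] [h𝔭p : 𝔭.LiesOver (Ideal.span {(p : ℤ)})]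
  (v : HeightOneSpectrum (𝓞 (maximalRealSubfield F))) [hPv : 𝔭.LiesOver v.asIdeal]
variable {r : ℕ} (l : Fin r → 𝓞 F) (k : Type*) [Field k]

include hpm h𝔭 h𝔭p hPv in
/-- **THE RECORD'S SPHERICAL HECKE ALGEBRA ON EVERY CM SUBFIELD `F ⊆ ℚ(ζₘ)` IS COMMUTATIVE AT EVERY PLACE OF `F⁺`
ABOVE A PRIME `p ∤ m`** (good for `H`): `v` stays prime in `F` (`(−1) · H_F ∈ ⟨p · H_F⟩`, file 293) and file 236
applies, or `v` has exactly two primes above it (file 293) and file 250 applies — the exceptional set of R9 is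
contained in the places above the primes dividing `m` together with the bad places of `H`. -/
theorem recordCommutative_cyclotomic_subfield
    (hl : Submodule.span (𝓞 (maximalRealSubfield F)) (Set.range l) = ⊤)
    {H : Matrix (Fin 3) (Fin 3) F} (hH : H.IsHermitian) (hdet : IsUnit H.det)
    (hbad : ∀ w : HeightOneSpectrum (𝓞 F), w.asIdeal.LiesOver v.asIdeal → w ∉ badSet H) :
    RecordCommutative F v l k H := by
  by_cases hmem : (QuotientGroup.mk (-1) : (ZMod m)ˣ ⧸ zmodSubgroup m L F) ∈
      Subgroup.zpowers (QuotientGroup.mk (ZMod.unitOfCoprime p hpm))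
  · obtain ⟨w, hmap⟩ := (exists_map_eq_iff_mem_zpowers m L F p hpm 𝔭 v).mpr hmem
    exact recordCommutative_of_map_eq F v l k w hmap hl hH hdet (hbad w (liesOver_of_map_eq F v w hmap))
  · exact recordCommutative_of_ncard_primesOver_eq_two F v l k
      ((ncard_primesOver_eq_two_iff_notMem m L F p hpm 𝔭 v).mpr hmem) hl hH hdet hbad

include hpm h𝔭 h𝔭p hPv in
/-- **`k[X]` at every non-split place above `p ∤ m`**: when `(−1) · H_F ∈ ⟨p · H_F⟩`, `v` stays prime in `F` and
`H(U(1 ⊗ H), K_v) ≃ k[X]` (file 236). -/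
theorem recordPolynomial_cyclotomic_subfield_of_mem
    (hmem : (QuotientGroup.mk (-1) : (ZMod m)ˣ ⧸ zmodSubgroup m L F) ∈
      Subgroup.zpowers (QuotientGroup.mk (ZMod.unitOfCoprime p hpm)))
    (hl : Submodule.span (𝓞 (maximalRealSubfield F)) (Set.range l) = ⊤)
    {H : Matrix (Fin 3) (Fin 3) F} (hH : H.IsHermitian) (hdet : IsUnit H.det)
    (hbad : ∀ w : HeightOneSpectrum (𝓞 F), w.asIdeal.LiesOver v.asIdeal → w ∉ badSet H) :
    RecordPolynomial F v l k H := by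
  obtain ⟨w, hmap⟩ := (exists_map_eq_iff_mem_zpowers m L F p hpm 𝔭 v).mpr hmem
  exact recordPolynomial_of_map_eq F v l k w hmap hl hH hdet (hbad w (liesOver_of_map_eq F v w hmap))

end Cyclotomic

section Intrinsic

variable (m : ℕ) [NeZero m] (L : Type*) [Field L] [NumberField L] [IsCyclotomicExtension {m} ℚ L] [IsCMField L]
  (F : IntermediateField ℚ L) [IsCMField F]
variable (v : HeightOneSpectrum (𝓞 (maximalRealSubfield F)))

omit [NeZero m] [IsCyclotomicExtension {m} ℚ L] [IsCMField L] [IsCMField F] in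
/-- If `v` lies above `p` and `m ∉ v`, then `p` is coprime to `m`: a prime `p ∣ m` would put `m ∈ (p) ⊆ v`. -/
theorem coprime_of_notMem (p : ℕ) [hp : Fact p.Prime] [hv : v.asIdeal.LiesOver (Ideal.span {(p : ℤ)})]
    (hmv : ((m : ℕ) : 𝓞 (maximalRealSubfield F)) ∉ v.asIdeal) : p.Coprime m := by
  rw [Nat.Prime.coprime_iff_not_dvd hp.out]
  intro hdvd
  apply hmv
  obtain ⟨c, hc⟩ := hdvd
  have hmem : ((m : ℕ) : ℤ) ∈ Ideal.span {(p : ℤ)} := by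
    rw [hc]; push_cast
    exact Ideal.mem_span_singleton.mpr (dvd_mul_right _ _)
  rw [Ideal.mem_of_liesOver v.asIdeal (Ideal.span {(p : ℤ)}) m, map_natCast] at hmem
  exact hmem

omit [NeZero m] [IsCyclotomicExtension {m} ℚ L] [IsCMField L] [IsCMField F] in
/-- **A place of `F⁺` with `m ∉ v` lies above a rational prime `p ∤ m`.** -/
theorem exists_prime_liesOver_of_notMem (hmv : ((m : ℕ) : 𝓞 (maximalRealSubfield F)) ∉ v.asIdeal) :
    ∃ p : ℕ, p.Prime ∧ p.Coprime m ∧ v.asIdeal.LiesOver (Ideal.span {(p : ℤ)}) := by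
  obtain ⟨p, hp, hv⟩ := exists_prime_liesOver (maximalRealSubfield F) v
  haveI : Fact p.Prime := ⟨hp⟩
  exact ⟨p, hp, coprime_of_notMem m L F v p hmv, hv⟩

/-- **THE INTRINSIC FORM: `H(U(1 ⊗ H), K_v)` IS COMMUTATIVE AT EVERY PLACE `v` OF `F⁺` WITH `m ∉ v`**, for every CM
subfield `F ⊆ ℚ(ζₘ)` and every `H` good at the places above `v`: `v` lies above a prime `p ∤ m`
(`exists_prime_liesOver_of_notMem`), a prime `𝔭` of `𝓞_F` lies above `v` (Mathlib's `Ideal.nonempty_primesOver`),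
and `recordCommutative_cyclotomic_subfield` applies. -/
theorem recordCommutative_cyclotomic_subfield_of_notMem
    (hmv : ((m : ℕ) : 𝓞 (maximalRealSubfield F)) ∉ v.asIdeal)
    {r : ℕ} (l : Fin r → 𝓞 F) (k : Type*) [Field k]
    (hl : Submodule.span (𝓞 (maximalRealSubfield F)) (Set.range l) = ⊤)
    {H : Matrix (Fin 3) (Fin 3) F} (hH : H.IsHermitian) (hdet : IsUnit H.det)
    (hbad : ∀ w : HeightOneSpectrum (𝓞 F), w.asIdeal.LiesOver v.asIdeal → w ∉ badSet H) :
    RecordCommutative F v l k H := by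
  obtain ⟨p, hp, hpm, hv⟩ := exists_prime_liesOver_of_notMem m L F v hmv
  haveI : Fact p.Prime := ⟨hp⟩
  haveI := hv
  obtain ⟨𝔭, h𝔭, h𝔭v⟩ := (Ideal.nonempty_primesOver (S := 𝓞 F) v.asIdeal).some
  haveI := h𝔭
  haveI := h𝔭v
  haveI : 𝔭.LiesOver (Ideal.span {(p : ℤ)}) := Ideal.LiesOver.trans 𝔭 v.asIdeal (Ideal.span {(p : ℤ)})
  exact recordCommutative_cyclotomic_subfield m L F p hpm 𝔭 v l k hl hH hdet hbad

end Intrinsic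

end Summit.Ventures.HodgeRepro2.T5CyclotomicSubfieldHeckeCommutative
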